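import Literature.IUT.HodgeTheaters.ConventionsCatIsomorphismGroup
import Literature.IUT.HodgeTheaters.SplitFrobenioids
import HarnessLib

/-!
# [IUTchI] §0 "Monoids and Categories" (p. 33), the LIFT direction: the natural map `Isom(D₁, D₂) → Isom(C₁, C₂)`
# ALONG a structure functor `p : C → D` read UPWARD (sub- or over-categories "reconstructed category-theoretically")

S. Mochizuki, *Inter-universal Teichmüller theory I*, kurims manuscript (May 2020), §0 "Monoids and Categories",
p. 33: *"We shall refer to an isomorphism class of equivalences between two categories as an isomorphism between the
two categories in question"*; Remark 3.2.1 (i) p. 73 l. 60–62 (*"the phrase “reconstructed category-theoretically” is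
interpreted as meaning “preserved by equivalences of categories”"*); Example 3.3 (iii) p. 79: *"(a) the subcategory
`𝒟⊢_v ⊆ 𝒟_v` may be reconstructed category-theoretically from `𝒟_v`"* (l. 33–35), *"(d) `𝒞⊢_v` may be reconstructed
category-theoretically from `ℱ̲_v`"* (l. 50–51); Corollary 5.3 (iv) p. 144 l. 22–23 (*"the natural homomorphism
`Aut(ℱ̲_v) → Aut(𝒟_v)`"*, at `v ∈ 𝕍^bad` — the MODEL for our §0 reading of (a)/(d) as induced homomorphisms of `Aut(−)`,
which is OURS, not a phrase of Example 3.3) and l. 39–40 (*"surjectivity follows immediately from the construction"*)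
([IUTchI] §0 p.33) [claim: Mochizuki2012, status: disputed] (D-0012 claim key, status DISPUTED —
this file is §0 VOCABULARY plus elementary category theory; nothing of the series is asserted, no side is taken on
[IUTchIII] Cor. 3.12).

abc-iut-L5-t4's `ConventionsCatIsomorphismGroup.lean` (p491065) reads a structure functor `p : C ⥤ D` DOWNWARD: under
the displayed binders `HasUnder` (under every `Ψ : C₁ ⥲ C₂` lies some `Θ : D₁ ⥲ D₂`, `Ψ ⋙ p₂ ≅ p₁ ⋙ Θ`) and
`UnderUnique`, the natural map `descend : Isom(C₁, C₂) → Isom(D₁, D₂)`, the homomorphism `descendHom : Aut(C) →* Aut(D)`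
and the functor of one-object kinds `kindFunctor`.  Several printed passages go the OTHER way, along an inclusion of a
(not necessarily full) subcategory — [IUTchI] Ex. 3.3 (iii) (a) `𝒟_v ↦ 𝒟⊢_v` along `𝒟⊢_v ⊆ 𝒟_v`, (d) `ℱ̲_v ↦ 𝒞⊢_v`
along `𝒞⊢_v ⊆ 𝒞_v`, Ex. 3.2 (iii) `ℱ̲_v ↦ 𝒞_v` — and abc-iut-L5-t2 typed them as `ReconstructibleAlong Φ` (our gloss: every
self-equivalence downstairs has SOME self-equivalence upstairs over it; `SplitFrobenioids.lean`): existence only.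
This companion (NEW file, the landed ones untouched; seat abc-iut-w4-d047) supplies the mirror image of t4's API over
the SAME relation `LiesUnder`:

* `HasLift p₁ p₂` (over every `Θ` lies some `Ψ`) — `hasLift_iff_reconstructibleAlong` identifies t2's
  `ReconstructibleAlong Φ` with `HasLift Φ Φ`; `LiftUnique p₁ p₂` (two equivalences over the same `Θ` are isomorphic);
* the natural map `ascend : Isom(D₁, D₂) → Isom(C₁, C₂)` with `ascend_mk`, `ascend_comp`, `ascend_refl`, the homomorphism
  `ascendHom : Aut(D) →* Aut(C)` and the functor of one-object kinds `liftKindFunctor` (the shape of the slots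
  `dashOfBase` / `dashOf` of t2's `HodgeTheaterModel` and `toFm` of t4's `FKit` in design F1);
* DISCHARGE lemmas for the uniqueness binder: `liftUnique_of_faithful_of_iso_lift` (a FAITHFUL `p₂` along which
  isomorphisms between image objects lift — the situation of abc-iut-w4-d047's `exists_iso_lift`,
  `ReconstructibleAlongNonFull.lean`, i.e. of `𝒞⊢_v ⊆ 𝒞_v`) and `liftUnique_of_full_faithful` (a fully faithful `p₂`,
  i.e. `𝒟⊢_v ⊆ 𝒟_v`);
* the two natural maps are mutually inverse when all four binders hold (`descend_ascend`, `ascend_descend`), whence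
  `descendBijective_of_hasLift_of_liftUnique` — Cor. 5.3's "is bijective" in t4's currency from
  {`HasUnder`, `UnderUnique`, `HasLift`, `LiftUnique`}.

No instance, no notation, no `Prop` fact (the two predicates have parameters and are displayed binders, never
asserted); typed ≠ proved elsewhere.  (Doc-only revision: referee rule of M26-F2 applied — quotation marks enclose
verbatim print only, the `Aut`-homomorphism reading is marked as ours; statements and proofs are byte-identical to the
first landing.)
-/

namespace Literature.IUT.HodgeTheaters

open CategoryTheory

universe v₁ v₂ v₃ v₄ v₅ v₆ u₁ u₂ u₃ u₄ u₅ u₆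

namespace CatIsomorphism

/-! ### The natural map `Isom(D₁, D₂) → Isom(C₁, C₂)` along a passage read upward -/

section Ascend

variable {C₁ : Type u₁} [Category.{v₁} C₁] {C₂ : Type u₂} [Category.{v₂} C₂]
  {D₁ : Type u₃} [Category.{v₃} D₁] {D₂ : Type u₄} [Category.{v₄} D₂]
  (p₁ : C₁ ⥤ D₁) (p₂ : C₂ ⥤ D₂)

/-- EXISTENCE hypothesis for the lifted natural map: over every equivalence `Θ : D₁ ⥲ D₂` lies some equivalence
`Ψ : C₁ ⥲ C₂` (`Ψ ⋙ p₂ ≅ p₁ ⋙ Θ`) — "reconstructed category-theoretically" in the reading of [IUTchI] Rmk. 3.2.1 (i)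
for a sub- or over-category; a displayed binder, never asserted here. ([IUTchI] §0 p.33) [claim: Mochizuki2012, status: disputed] -/
def HasLift : Prop := ∀ Θ : D₁ ≌ D₂, ∃ Ψ : C₁ ≌ C₂, Nonempty (LiesUnder p₁ p₂ Ψ Θ)

/-- UNIQUENESS hypothesis for the lifted natural map: two equivalences `C₁ ⥲ C₂` lying over the same `Θ` are
isomorphic (automatic along a faithful `p₂` reflecting isomorphisms of image objects,
`liftUnique_of_faithful_of_iso_lift`); a displayed binder. ([IUTchI] §0 p.33) [claim: Mochizuki2012, status: disputed] -/
def LiftUnique : Prop :=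
  ∀ (Θ : D₁ ≌ D₂) (Ψ Ψ' : C₁ ≌ C₂), Nonempty (LiesUnder p₁ p₂ Ψ Θ) → Nonempty (LiesUnder p₁ p₂ Ψ' Θ) →
    Nonempty (Ψ.functor ≅ Ψ'.functor)

variable {p₁ p₂}

/-- Under `LiftUnique`, the class of the equivalence lying over `Θ` depends only on the class of `Θ`.
([IUTchI] §0 p.33) [claim: Mochizuki2012, status: disputed] -/
theorem ascend_wd (hu : LiftUnique p₁ p₂) {Θ Θ' : D₁ ≌ D₂} {Ψ Ψ' : C₁ ≌ C₂}
    (h : Nonempty (LiesUnder p₁ p₂ Ψ Θ)) (h' : Nonempty (LiesUnder p₁ p₂ Ψ' Θ'))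
    (j : Nonempty (Θ.functor ≅ Θ'.functor)) : CatIsomorphism.mk Ψ = CatIsomorphism.mk Ψ' := by
  obtain ⟨h⟩ := h
  obtain ⟨j⟩ := j
  obtain ⟨i⟩ := hu Θ' Ψ Ψ' ⟨h.ofIsoLower j⟩ h'
  exact sound i

/-- **The natural map `Isom(D₁, D₂) → Isom(C₁, C₂)`** along a passage read upward ([IUTchI] Ex. 3.3 (iii) (a), (d):
`𝒟_v ↦ 𝒟⊢_v`, `ℱ̲_v ↦ 𝒞⊢_v` ON ISOMORPHISMS OF CATEGORIES): the class of `Θ` goes to the class of the (essentially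
unique) equivalence lying over `Θ`.  Defined from the two displayed hypotheses `HasLift` / `LiftUnique`; nothing is
asserted. ([IUTchI] §0 p.33) [claim: Mochizuki2012, status: disputed] -/
noncomputable def ascend (hl : HasLift p₁ p₂) (hu : LiftUnique p₁ p₂) :
    CatIsomorphism D₁ D₂ → CatIsomorphism C₁ C₂ :=
  Quotient.lift (s := equivSetoid D₁ D₂) (fun Θ => CatIsomorphism.mk (hl Θ).choose)
    fun Θ Θ' (j : Nonempty (Θ.functor ≅ Θ'.functor)) =>
      ascend_wd hu (hl Θ).choose_spec (hl Θ').choose_spec j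

/-- The lifted natural map on representatives: if `Ψ` lies over `Θ` then `ascend [Θ] = [Ψ]`.
([IUTchI] §0 p.33) [claim: Mochizuki2012, status: disputed] -/
theorem ascend_mk (hl : HasLift p₁ p₂) (hu : LiftUnique p₁ p₂) {Θ : D₁ ≌ D₂} {Ψ : C₁ ≌ C₂}
    (h : Nonempty (LiesUnder p₁ p₂ Ψ Θ)) : ascend hl hu (CatIsomorphism.mk Θ) = CatIsomorphism.mk Ψ := by
  change CatIsomorphism.mk (hl Θ).choose = CatIsomorphism.mk Ψ
  exact ascend_wd hu (hl Θ).choose_spec h ⟨Iso.refl _⟩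

/-- **`descend ∘ ascend = id`**: lifting `Θ` to `Ψ` and descending again returns the class of `Θ` (under
`UnderUnique`). ([IUTchI] §0 p.33) [claim: Mochizuki2012, status: disputed] -/
theorem descend_ascend (he : HasUnder p₁ p₂) (hu : UnderUnique p₁ p₂) (hl : HasLift p₁ p₂)
    (hu' : LiftUnique p₁ p₂) (b : CatIsomorphism D₁ D₂) : descend he hu (ascend hl hu' b) = b := by
  obtain ⟨Θ, rfl⟩ := mk_surjective b
  obtain ⟨Ψ, h⟩ := hl Θ
  rw [ascend_mk hl hu' h, descend_mk he hu h]

/-- **`ascend ∘ descend = id`**: descending `Ψ` to `Θ` and lifting again returns the class of `Ψ` (under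
`LiftUnique`). ([IUTchI] §0 p.33) [claim: Mochizuki2012, status: disputed] -/
theorem ascend_descend (he : HasUnder p₁ p₂) (hu : UnderUnique p₁ p₂) (hl : HasLift p₁ p₂)
    (hu' : LiftUnique p₁ p₂) (a : CatIsomorphism C₁ C₂) : ascend hl hu' (descend he hu a) = a := by
  obtain ⟨Ψ, rfl⟩ := mk_surjective a
  obtain ⟨Θ, h⟩ := he Ψ
  rw [descend_mk he hu h, ascend_mk hl hu' h]

/-- **Cor. 5.3's "the natural map is bijective" from the four binders**: if under every `Ψ` lies an essentially
unique `Θ` AND over every `Θ` lies an essentially unique `Ψ`, then `descend` is a bijection with inverse `ascend`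
(abc-iut-L5-t4's `DescendBijective`). ([IUTchI] Cor 5.3 p.144) [claim: Mochizuki2012, status: disputed] -/
theorem descendBijective_of_hasLift_of_liftUnique (he : HasUnder p₁ p₂) (hu : UnderUnique p₁ p₂)
    (hl : HasLift p₁ p₂) (hu' : LiftUnique p₁ p₂) : DescendBijective p₁ p₂ he hu :=
  Function.bijective_iff_has_inverse.2 ⟨ascend hl hu', ascend_descend he hu hl hu', descend_ascend he hu hl hu'⟩

/-! ### Discharging the uniqueness binder -/

/-- **`LiftUnique` along a FAITHFUL functor reflecting isomorphisms of image objects**: if `p₂` is faithful and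
every isomorphism `p₂ X ≅ p₂ Y` is `p₂` of an isomorphism `X ≅ Y` (abc-iut-w4-d047's `exists_iso_lift` for the
non-full `𝒞⊢_v ⊆ 𝒞_v` of [IUTchI] Ex. 3.3 (i)), then two equivalences over the same `Θ` are isomorphic: the
componentwise lifts of `Ψ ⋙ p₂ ≅ p₁ ⋙ Θ ≅ Ψ' ⋙ p₂` are natural because `p₂` is faithful. [folklore]
([IUTchI] §0 p.33) [claim: Mochizuki2012, status: disputed] -/
theorem liftUnique_of_faithful_of_iso_lift [p₂.Faithful]
    (hiso : ∀ {X Y : C₂} (s : p₂.obj X ≅ p₂.obj Y), ∃ i : X ≅ Y, p₂.map i.hom = s.hom) :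
    LiftUnique p₁ p₂ := by
  intro Θ Ψ Ψ' h h'
  obtain ⟨h⟩ := h
  obtain ⟨h'⟩ := h'
  let k : Ψ.functor ⋙ p₂ ≅ Ψ'.functor ⋙ p₂ := h ≪≫ h'.symm
  have hk : ∀ X : C₁, ∃ i : Ψ.functor.obj X ≅ Ψ'.functor.obj X, p₂.map i.hom = (k.app X).hom :=
    fun X => hiso (k.app X)
  choose i hi using hk
  refine ⟨NatIso.ofComponents (fun X => i X) ?_⟩
  intro X Y f
  apply p₂.map_injective
  rw [p₂.map_comp, p₂.map_comp, hi, hi]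
  exact k.hom.naturality f

/-- **`LiftUnique` along a FULLY FAITHFUL functor** (the full subcategory `𝒟⊢_v ⊆ 𝒟_v` of [IUTchI] Ex. 3.3 (i)):
no hypothesis beyond fullness and faithfulness. [folklore] ([IUTchI] §0 p.33) [claim: Mochizuki2012, status: disputed] -/
theorem liftUnique_of_full_faithful [p₂.Full] [p₂.Faithful] : LiftUnique p₁ p₂ :=
  liftUnique_of_faithful_of_iso_lift fun s => ⟨p₂.preimageIso s, by
    rw [Functor.preimageIso_hom, Functor.map_preimage]⟩

end Ascend

/-! ### Compatibility with composition; `Aut(D) → Aut(C)` as a homomorphism; the one-object kinds -/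

section AscendComp

variable {C₁ : Type u₁} [Category.{v₁} C₁] {C₂ : Type u₂} [Category.{v₂} C₂] {C₃ : Type u₃} [Category.{v₃} C₃]
  {D₁ : Type u₄} [Category.{v₄} D₁] {D₂ : Type u₅} [Category.{v₅} D₂] {D₃ : Type u₆} [Category.{v₆} D₃]
  {p₁ : C₁ ⥤ D₁} {p₂ : C₂ ⥤ D₂} {p₃ : C₃ ⥤ D₃}

/-- **The lifted natural map is compatible with composition**: `ascend ([Θ] ∘ [Θ']) = ascend [Θ] ∘ ascend [Θ']`
(pasting of the two squares, abc-iut-L5-t4's `LiesUnder.trans`). ([IUTchI] §0 p.33) [claim: Mochizuki2012, status: disputed] -/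
theorem ascend_comp (hl₁₂ : HasLift p₁ p₂) (hu₁₂ : LiftUnique p₁ p₂) (hl₂₃ : HasLift p₂ p₃)
    (hu₂₃ : LiftUnique p₂ p₃) (hl₁₃ : HasLift p₁ p₃) (hu₁₃ : LiftUnique p₁ p₃)
    (a : CatIsomorphism D₁ D₂) (b : CatIsomorphism D₂ D₃) :
    ascend hl₁₃ hu₁₃ (a.comp b) = (ascend hl₁₂ hu₁₂ a).comp (ascend hl₂₃ hu₂₃ b) := by
  obtain ⟨Θ, rfl⟩ := mk_surjective a
  obtain ⟨Θ', rfl⟩ := mk_surjective b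
  obtain ⟨Ψ, ⟨h⟩⟩ := hl₁₂ Θ
  obtain ⟨Ψ', ⟨h'⟩⟩ := hl₂₃ Θ'
  rw [ascend_mk hl₁₂ hu₁₂ ⟨h⟩, ascend_mk hl₂₃ hu₂₃ ⟨h'⟩, mk_comp_mk, mk_comp_mk,
    ascend_mk hl₁₃ hu₁₃ ⟨h.trans h'⟩]

/-- The lifted natural map sends the identity to the identity. ([IUTchI] §0 p.33) [claim: Mochizuki2012, status: disputed] -/
theorem ascend_refl {p : C₁ ⥤ D₁} (hl : HasLift p p) (hu : LiftUnique p p) :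
    ascend hl hu (CatIsomorphism.refl D₁) = CatIsomorphism.refl C₁ := by
  rw [refl_eq_mk, refl_eq_mk, ascend_mk hl hu ⟨LiesUnder.refl p⟩]

end AscendComp

section AutHomLift

variable {C : Type u₁} [Category.{v₁} C] {D : Type u₂} [Category.{v₂} D] {p : C ⥤ D}

/-- **The induced homomorphism `Aut(𝒟_v) → Aut(𝒟⊢_v)` / `Aut(ℱ̲_v) → Aut(𝒞⊢_v)`** (our §0 reading of [IUTchI] Ex. 3.3
(iii) (a), (d) on isomorphisms of categories, modelled on print's "the natural homomorphism `Aut(ℱ̲_v) → Aut(𝒟_v)`" of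
Cor. 5.3 (iv)): the lifted map on `Aut(−)` is a homomorphism of groups (from `ascend_comp`,
`ascend_refl`), under the displayed binders. ([IUTchI] §0 p.33) [claim: Mochizuki2012, status: disputed] -/
noncomputable def ascendHom (hl : HasLift p p) (hu : LiftUnique p p) : CatAut D →* CatAut C where
  toFun := ascend hl hu
  map_one' := by rw [CatAut.one_def, CatAut.one_def, ascend_refl]
  map_mul' a b := by rw [CatAut.mul_def, CatAut.mul_def, ascend_comp hl hu hl hu hl hu]

/-- `ascendHom` is `ascend` on elements. ([IUTchI] §0 p.33) [claim: Mochizuki2012, status: disputed] -/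
theorem ascendHom_apply (hl : HasLift p p) (hu : LiftUnique p p) (b : CatAut D) :
    ascendHom hl hu b = ascend hl hu b := rfl

/-- `ascendHom` is a left inverse of abc-iut-L5-t4's `descendHom` when all four binders hold.
([IUTchI] §0 p.33) [claim: Mochizuki2012, status: disputed] -/
theorem ascendHom_descendHom (he : HasUnder p p) (hu : UnderUnique p p) (hl : HasLift p p)
    (hu' : LiftUnique p p) (a : CatAut C) : ascendHom hl hu' (descendHom he hu a) = a :=
  ascend_descend he hu hl hu' a

/-- `descendHom` is a left inverse of `ascendHom` when all four binders hold.
([IUTchI] §0 p.33) [claim: Mochizuki2012, status: disputed] -/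
theorem descendHom_ascendHom (he : HasUnder p p) (hu : UnderUnique p p) (hl : HasLift p p)
    (hu' : LiftUnique p p) (b : CatAut D) : descendHom he hu (ascendHom hl hu' b) = b :=
  descend_ascend he hu hl hu' b

/-- **The passage `D ↦ C` on one-object kinds** (design F1 of the «genuine ℱ-prime-strip kit» hub: the slots
`dashOfBase v` (`𝒟_v ↦ 𝒟⊢_v`) of abc-iut-L5-t2's `HodgeTheaterModel` and `toFm v` (`ℱ_v ↦ ℱ⊢_v`) of abc-iut-L5-t4's
`FKit`): Mathlib's `SingleObj.mapHom` of `ascendHom`. ([IUTchI] §0 p.33) [claim: Mochizuki2012, status: disputed] -/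
noncomputable def liftKindFunctor (hl : HasLift p p) (hu : LiftUnique p p) :
    SingleObj (CatAut D) ⥤ SingleObj (CatAut C) :=
  SingleObj.mapHom (CatAut D) (CatAut C) (ascendHom hl hu)

/-- On endomorphisms of the unique object, `liftKindFunctor` is `ascend`. ([IUTchI] §0 p.33) [claim: Mochizuki2012, status: disputed] -/
theorem liftKindFunctor_map (hl : HasLift p p) (hu : LiftUnique p p)
    (b : SingleObj.star (CatAut D) ⟶ SingleObj.star (CatAut D)) :
    (liftKindFunctor hl hu).map b = ascend hl hu b := rfl

/-- `liftKindFunctor` followed by abc-iut-L5-t4's `kindFunctor` is the identity on endomorphisms when all four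
binders hold (so the two one-object kinds are isomorphic through the natural maps).
([IUTchI] §0 p.33) [claim: Mochizuki2012, status: disputed] -/
theorem kindFunctor_map_liftKindFunctor_map (he : HasUnder p p) (hu : UnderUnique p p) (hl : HasLift p p)
    (hu' : LiftUnique p p) (b : SingleObj.star (CatAut D) ⟶ SingleObj.star (CatAut D)) :
    (kindFunctor he hu).map ((liftKindFunctor hl hu').map b) = b :=
  descend_ascend he hu hl hu' b

end AutHomLift

/-! ### abc-iut-L5-t2's `ReconstructibleAlong` is `HasLift` -/

section Reconstructible

variable {S T : Type u₁} [Category.{u₁} S] [Category.{u₁} T] (Φ : T ⥤ S)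

/-- **`ReconstructibleAlong Φ ↔ HasLift Φ Φ`**: abc-iut-L5-t2's typing of "reconstructed category-theoretically"
(every self-equivalence of `S` lifts, compatibly, along `Φ : T ⥤ S`; `SplitFrobenioids.lean`) IS the existence
binder of the lifted natural map for the structure functor `Φ` (the two compatibility isomorphisms are mutually
inverse). ([IUTchI] §0 p.33) [claim: Mochizuki2012, status: disputed] -/
theorem hasLift_iff_reconstructibleAlong : HasLift Φ Φ ↔ ReconstructibleAlong Φ := by
  constructor
  · intro h e
    obtain ⟨e', ⟨i⟩⟩ := h e
    exact ⟨e', ⟨i.symm⟩⟩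
  · intro h e
    obtain ⟨e', ⟨i⟩⟩ := h e
    exact ⟨e', ⟨i.symm⟩⟩

/-- From `ReconstructibleAlong Φ` (existence) and `LiftUnique Φ Φ`, the homomorphism `Aut(S) →* Aut(T)`
(our §0 reading of the reconstructed category's functoriality, [IUTchI] Ex. 3.3 (iii) (a)/(d) on isomorphisms).
([IUTchI] §0 p.33) [claim: Mochizuki2012, status: disputed] -/
noncomputable def ascendHomOfReconstructible (h : ReconstructibleAlong Φ) (hu : LiftUnique Φ Φ) :
    CatAut S →* CatAut T :=
  ascendHom ((hasLift_iff_reconstructibleAlong Φ).2 h) hu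

/-- `ascendHomOfReconstructible` on representatives: if `e'` lifts `e` (`Φ ⋙ e ≅ e' ⋙ Φ`) then `[e] ↦ [e']`.
([IUTchI] §0 p.33) [claim: Mochizuki2012, status: disputed] -/
theorem ascendHomOfReconstructible_mk (h : ReconstructibleAlong Φ) (hu : LiftUnique Φ Φ) {e : S ≌ S} {e' : T ≌ T}
    (i : Φ ⋙ e.functor ≅ e'.functor ⋙ Φ) :
    ascendHomOfReconstructible Φ h hu (CatIsomorphism.mk e) = CatIsomorphism.mk e' :=
  ascend_mk _ hu ⟨i.symm⟩

end Reconstructible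

end CatIsomorphism

end Literature.IUT.HodgeTheaters
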